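import Summits.ValiantsHypothesis.ValiantsHypothesis.Theorems.LacunarySymmetroidMatrixDescartesDoorA26WallBubblingBubblingClusters

/-!
# Wall bubbling for `DoorA26` — (W-split) structure, part B4: THE EQUALITY CASE OF THE INTERVAL COUNT (tight chains are chains of consecutive intervals)

HONEST FRAMING.  Combinatorial lemma for obligation (W) `stub_weylFaces` of `Cruxes/DoorA26/Lines/wall_bubbling.lean` (stmt-ValiantsHypothesis-19979
`DoorA26`; OPEN, typed, never asserted), W2 seat val-sym-door-p1 g15; named residual «(W-split) multi-scale linking» of
`Cruxes/DoorA26/Lines/wall_bubbling_ConfluentDoor.lean` rev 4.  The tight-chain structure theorem (`…WallBubblingTightChain.tightChain`, conclusion (iv))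
delivers the EQUALITY `Σ_c (|Λ_c| − 1) = |V| − 1` in B9's interval count (`Bubbling.interval_count`, p617041) for the monotonically ordered active
value sets `Λ_c ⊆ V` of the clusters.  This file is the equality case of B9, pure finite combinatorics:

* `interval_count_tight` — nonempty `Λ c ⊆ V`, monotonically ordered (`c < c' ⇒ Λ c ≤ Λ c'` elementwise), with `Σ_c (|Λ c| − 1) = |V| − 1` and at
  least one cluster ⇒ (a) COVERAGE: every value of `V` is active in some cluster; (b) CONVEXITY: each `Λ c` is an interval of `V` (a value of `V` between
  two active values of cluster `c` is active in `c`); (c) LINKING: consecutive clusters share an active value (hence exactly one, the common endpoint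
  `max Λ c = min Λ (c+1)`).

So a tight chain is a chain of CONSECUTIVE OVERLAPPING INTERVALS of the fifteen values, adjacent intervals hinged at one shared value — the shape in
which the pencil-level residual (end-deficit / middle split / broken chain) is stated.

No new definitions; nothing here bears on `DoorA26`, `MatrixDescartes` (stmt-ValiantsHypothesis-18050) or `VP ≠ VNP`; (W)/(W-split)/`ConfluentDoor26` OPEN.

[folklore] equality case of a disjoint-union count.  [this work] the bookkeeping.
-/

-- `Summit.ValiantsHypothesis.ValiantsHypothesis.…` repeats a component by the D-0017 layout
-- (single-conjunct summit), which the `dupNamespace` linter flags; the name is mandated.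
set_option linter.dupNamespace false

namespace Summit.ValiantsHypothesis.ValiantsHypothesis.Theorems.LacunarySymmetroidMatrixDescartes.WallBubbling

open Finset
open scoped BigOperators

/-- **THE INTERVAL COUNT, EQUALITY CASE.**  See the module docstring. [this work] -/
theorem interval_count_tight (V : Finset ℝ) {C : ℕ} (Λ : Fin C → Finset ℝ) (hne : ∀ c, (Λ c).Nonempty)
    (hsub : ∀ c, Λ c ⊆ V) (hmono : ∀ c c', c < c' → ∀ w ∈ Λ c, ∀ w' ∈ Λ c', w ≤ w')
    (hC : 0 < C) (htight : ∑ c, ((Λ c).card - 1) = V.card - 1) :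
    (∀ w ∈ V, ∃ c, w ∈ Λ c) ∧
    (∀ c, ∀ w₁ ∈ Λ c, ∀ w₂ ∈ Λ c, ∀ w ∈ V, w₁ ≤ w → w ≤ w₂ → w ∈ Λ c) ∧
    (∀ c c' : Fin C, c.val + 1 = c'.val → ∃ w, w ∈ Λ c ∧ w ∈ Λ c') := by
  classical
  obtain ⟨C', rfl⟩ : ∃ C', C = C' + 1 := ⟨C - 1, by omega⟩
  -- B9's construction: drop the maximum of each cluster
  set A : Fin (C' + 1) → Finset ℝ := fun c => (Λ c).erase ((Λ c).max' (hne c)) with hA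
  have hAcard : ∀ c, (A c).card = (Λ c).card - 1 := fun c =>
    Finset.card_erase_of_mem (Finset.max'_mem _ _)
  have hAlt : ∀ c, ∀ w ∈ A c, w < (Λ c).max' (hne c) := by
    intro c w hw
    obtain ⟨hne', hmem⟩ := Finset.mem_erase.mp hw
    exact lt_of_le_of_ne (Finset.le_max' _ _ hmem) hne'
  have hAsub : ∀ c, ∀ w ∈ A c, w ∈ Λ c := fun c w hw => (Finset.mem_erase.mp hw).2
  have hdisj : ∀ c c', c < c' → Disjoint (A c) (A c') := by
    intro c c' hcc'
    rw [Finset.disjoint_left]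
    intro w hw hw'
    have h1 : w < (Λ c).max' (hne c) := hAlt c w hw
    have h2 : (Λ c).max' (hne c) ≤ w := hmono c c' hcc' _ (Finset.max'_mem _ _) w (hAsub c' w hw')
    linarith
  have hpd : (↑(Finset.univ : Finset (Fin (C' + 1))) : Set (Fin (C' + 1))).PairwiseDisjoint A := by
    intro c _ c' _ hcc'
    change Disjoint (A c) (A c')
    rcases lt_or_gt_of_ne hcc' with hlt | hgt
    · exact hdisj c c' hlt
    · exact (hdisj c' c hgt).symm
  set top : ℝ := (Λ (Fin.last C')).max' (hne _) with htop
  have htopV : top ∈ V := hsub _ (Finset.max'_mem _ _)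
  have hletop : ∀ c, ∀ w ∈ Λ c, w ≤ top := by
    intro c w hw
    rcases (Fin.le_last c).lt_or_eq with hlt | heq
    · exact hmono c (Fin.last C') hlt w hw _ (Finset.max'_mem _ _)
    · subst heq; exact Finset.le_max' _ _ hw
  have hUsub : Finset.univ.biUnion A ⊆ V.erase top := by
    intro w hw
    obtain ⟨c, _, hwc⟩ := Finset.mem_biUnion.mp hw
    refine Finset.mem_erase.mpr ⟨?_, hsub c (hAsub c w hwc)⟩
    exact ne_of_lt (lt_of_lt_of_le (hAlt c w hwc) (hletop c _ (Finset.max'_mem _ _)))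
  -- equality of cardinalities ⇒ the disjoint union IS `V.erase top`
  have hUcard : (Finset.univ.biUnion A).card = (V.erase top).card := by
    rw [Finset.card_biUnion hpd, Finset.card_erase_of_mem htopV, ← htight]
    exact Finset.sum_congr rfl fun c _ => hAcard c
  have hUeq : Finset.univ.biUnion A = V.erase top := Finset.eq_of_subset_of_card_le hUsub hUcard.ge
  -- every value below `top` lies STRICTLY below the maximum of some cluster containing it
  have hcoverA : ∀ w ∈ V, w ≠ top → ∃ c, w ∈ A c := by
    intro w hw hwt
    have : w ∈ Finset.univ.biUnion A := by rw [hUeq]; exact Finset.mem_erase.mpr ⟨hwt, hw⟩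
    obtain ⟨c, _, hwc⟩ := Finset.mem_biUnion.mp this
    exact ⟨c, hwc⟩
  -- (a) coverage
  have hcover : ∀ w ∈ V, ∃ c, w ∈ Λ c := by
    intro w hw
    by_cases hwt : w = top
    · exact ⟨Fin.last C', by rw [hwt]; exact Finset.max'_mem _ _⟩
    · obtain ⟨c, hc⟩ := hcoverA w hw hwt
      exact ⟨c, hAsub c w hc⟩
  -- (b) convexity
  have hconvex : ∀ c, ∀ w₁ ∈ Λ c, ∀ w₂ ∈ Λ c, ∀ w ∈ V, w₁ ≤ w → w ≤ w₂ → w ∈ Λ c := by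
    intro c w₁ hw₁ w₂ hw₂ w hw h1 h2
    obtain ⟨c', hc'⟩ := hcover w hw
    rcases lt_trichotomy c' c with hlt | heq | hgt
    · -- `w ≤ w₁ ≤ w`, so `w = w₁`
      have : w ≤ w₁ := hmono c' c hlt w hc' w₁ hw₁
      have hw' : w = w₁ := le_antisymm this h1
      rw [hw']; exact hw₁
    · subst heq; exact hc'
    · have : w₂ ≤ w := hmono c c' hgt w₂ hw₂ w hc'
      have hw' : w = w₂ := le_antisymm h2 this
      rw [hw']; exact hw₂
  refine ⟨hcover, hconvex, ?_⟩
  -- (c) consecutive clusters share the endpoint `max Λ c`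
  intro c c' hcc'
  have hlt : c < c' := by rw [Fin.lt_def]; omega
  refine ⟨(Λ c).max' (hne c), Finset.max'_mem _ _, ?_⟩
  by_cases hmt : (Λ c).max' (hne c) = top
  · -- then everything active at `c'` is squeezed to `top`
    obtain ⟨w', hw'⟩ := hne c'
    have h1 : (Λ c).max' (hne c) ≤ w' := hmono c c' hlt _ (Finset.max'_mem _ _) w' hw'
    have h2 : w' ≤ top := hletop c' w' hw'
    have : w' = (Λ c).max' (hne c) := by rw [hmt] at h1 ⊢; exact le_antisymm h2 h1
    rw [← this]; exact hw'
  · -- otherwise `max Λ c` lies strictly below the maximum of a LATER cluster `c''`, and `Λ c'` is squeezed in between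
    obtain ⟨c'', hc''⟩ := hcoverA _ (hsub c (Finset.max'_mem _ _)) hmt
    have hlt'' : c < c'' := by
      by_contra hge
      push Not at hge
      rcases hge.lt_or_eq with h | h
      · -- `c'' < c`: members of `Λ c''` are `≤` members of `Λ c`, but `max Λ c < max Λ c''`
        have h3 := hAlt c'' _ hc''
        have h4 : (Λ c'').max' (hne c'') ≤ (Λ c).max' (hne c) :=
          hmono c'' c h _ (Finset.max'_mem _ _) _ (Finset.max'_mem _ _)
        linarith
      · rw [h] at hc''; exact absurd (hAlt c _ hc'') (lt_irrefl _)
    obtain ⟨w', hw'⟩ := hne c'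
    have h1 : (Λ c).max' (hne c) ≤ w' := hmono c c' hlt _ (Finset.max'_mem _ _) w' hw'
    rcases (show c'.val ≤ c''.val by rw [Fin.lt_def] at hlt''; omega).lt_or_eq with h | h
    · have hlt' : c' < c'' := by rw [Fin.lt_def]; exact h
      have h2 : w' ≤ (Λ c).max' (hne c) := hmono c' c'' hlt' w' hw' _ (hAsub c'' _ hc'')
      have : w' = (Λ c).max' (hne c) := le_antisymm h2 h1
      rw [← this]; exact hw'
    · have heq : c' = c'' := Fin.ext h
      subst heq
      exact hAsub c' _ hc''

end Summit.ValiantsHypothesis.ValiantsHypothesis.Theorems.LacunarySymmetroidMatrixDescartes.WallBubbling
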